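import Summits.QuantumFields.BalabanUV.Beta.GAN24.PerturbedEffectiveFormVolumeLimit
import Summits.QuantumFields.BalabanUV.Beta.GAN24.CouplingEffectiveFormDecay

/-!
# `BalabanUV.Beta.GAN24.CouplingPerturbedVolumeLimit` — binder row G-an2-4 ∕ (CONV-C), route R7 «TWO CURRENCIES», PART 249: THE VALUE SECTOR FOR COUPLING LETTERS, VOLUME HALF —
# PART 151 §3–§4 and PART 152 §1–§2 VERBATIM for COUPLING letters `A = P(V₁) + P(V₂)ᴴ + diag W` (the class of the exact abelian covariant Laplacian): EL₂ of the perturbed fine propagator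
# `(Δ_a^{(k)} + u·A_t^{(k)})⁻¹` and of the perturbed block covariance `c_k(u)` modulo EL₁ of the backgrounds; the Neumann ratio `‖1 − Cst⁻¹•c_k(u)‖ ≤ 1 − γ_B∕(2Cst)` and the
# volume-uniform window decay of `c_k(u)` on PART 248's disc (unit b2b-balaban-gan24-p3, gen 65; v1; generator `HOME/b2b-balaban-gan24-p3/gen65/records/gen/gen249.py` over the tree
# texts of PARTs 151 ∕ 152)

NOT IN PRINT; OUR PROOF ([folklore] bookkeeping BY NAME over PART 151 (`pertInv_eq`, `one_sub_one_smul`, `one_add_smul_eq`, `tendsto_avgTow_pair_of_fine`), PART 152 (`avgTow_inv_calDalev_eq`,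
`one_sub_half_ratio_lt_one`), PART 236 (`norm_couplingLetter_mul_apply_le`, `tendsto_couplingLetter_mul_pair`, `perturbationLaws_couplingLetter`, `hPc_couplingLetter`), PART 144, PART 145 ∕ 146,
PART 138, PART 129 (`hdecB_pert_of_wCoercive`), NE2's `opNorm_avgTow_perturbed_sub_le`; [Balaban1987RG1] p. 264 LOCATES the `T ↗ ℤ^d` limit; nothing printed is a hypothesis).
HONEST FRAMING (cell contract, verbatim): «discharging `BetaPertH` makes Bałaban's UV stability UNCONDITIONAL — a real constructive-QFT result; it is NOT the
continuum limit and NOT the Clay problem.»  HONEST DEPENDENCY (verbatim): «continuum YM on T⁴ ⇐ BetaPertH ∧ nine spine estimates (0/9 proved); BetaPertH ⇐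
(D1) ∧ (D4) ∧ CAP+tail; G-an2-4 gates asym, D1 and NE2/3/4.»

WHAT THIS FILE PROVES (0 sorry, 0 `def`; `κ₀ = 2d(α+β)Cst + α′Cst`):
* **`tendsto_pertInv_pair_coupling`** (`d ≥ 3`, `Tκ₀ < 1`: EL₂ of `(Δ_a^{(k)} + u·A_t^{(k)})⁻¹` modulo EL₁ of `V₁, V₂, W`), **`tendsto_pertCov_pair_coupling`** (EL₂ of `c_k(u)` on the unit lattice).
* **`opNorm_one_sub_smul_pertCov_le_coupling`** (`Tκ₀ ≤ 1∕2`, `4Tκ₀Cst ≤ γ_B`: `‖1 − Cst⁻¹•c_k(u)‖ ≤ 1 − γ_B∕(2Cst)`), **`exists_windowDecay_pertCov_coupling`** (window decay of `c_k(u)` on the disc,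
  volume-uniform).
WHAT IT DOES NOT DO: the END (PART 250).  SUPPLIER work; NEVER «G-an2-4 closed»; NOT (CONV-C), NOT D1, NOT `BetaPertH`, NOT continuum, NOT Clay.  Records: `HOME/b2b-balaban-gan24-p3/gen65/README.md`.
-/

noncomputable section

open scoped BigOperators ComplexConjugate Matrix Matrix.Norms.L2Operator
open Filter Topology

namespace Summit.QuantumFields.BalabanUV.Beta.GAN24.CouplingPerturbedVolumeLimit

open Literature.MathematicalPhysics.QuantumFieldTheory.Balaban1983to89
open Literature.MathematicalPhysics.QuantumFieldTheory.Balaban1983to89.B5Prop11Plancherel (Tor fine fdiff shiftM unitVec Cst Cst_nonneg opNorm_reindex)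
open Literature.MathematicalPhysics.QuantumFieldTheory.Balaban1983to89.B5Block118 (QvOp bpt tstep)
open Literature.MathematicalPhysics.QuantumFieldTheory.Balaban1983to89.B5G183RateUnitTower (lev)
open Literature.MathematicalPhysics.QuantumFieldTheory.Balaban1983to89.B12Sec2to5 (l1 betaPrime510)
open Literature.MathematicalPhysics.QuantumFieldTheory.Balaban1983to89.Beta (Site windowMap IsInfiniteVolumeLimit)
open Literature.MathematicalPhysics.QuantumFieldTheory.Balaban1983to89.Beta.FreeLegDictionary (cubic)
open Literature.MathematicalPhysics.QuantumFieldTheory.Balaban1983to89.Beta.BlockKernelVolumeSockets (evenPeriod tendsto_evenPeriod)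
open Literature.MathematicalPhysics.QuantumFieldTheory.Balaban1983to89.Beta.VectorTails (castT castT_add castT_neg castT_single)
open Literature.MathematicalPhysics.QuantumFieldTheory.Balaban1983to89.Beta.VectorTailsPt (shiftM_mul_apply)
open Summit.QuantumFields.BalabanUV.T4Continuum
open Summit.QuantumFields.BalabanUV.T4Continuum.CovariantAveragingTower (avgTow)
open Summit.QuantumFields.BalabanUV.T4Continuum.BalabanAveragedTowerUnit (idx QBlev calGlev one_le_lev' norm_entry_le_opNorm unitCovB opNorm_QBlev_sq_le)
open Summit.QuantumFields.BalabanUV.T4Continuum.BalabanAveragedCoerciveTower (unitIdx)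
open Summit.QuantumFields.BalabanUV.T4Continuum.KingPairingPlantedLaw (calDalev calDalev_inv isUnit_det_calDalev opNorm_inv_calDalev_le)
open Summit.QuantumFields.BalabanUV.T4Continuum.FirstOrderBackgroundModel (LipschitzBackground Pmodel firstOrder)
open Summit.QuantumFields.BalabanUV.T4Continuum.BackgroundResolventLaw (add_smul_eq_mul_right opNorm_smul_le_of_le opNorm_inv_one_add_le)
open Summit.QuantumFields.BalabanUV.Beta.GAN24.VolumeLimitCovariance (QGQ_apply bpt_castT_add_tstep one_sub_smul_reindex opNorm_one_sub_smul_unitCovB_le)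
open Summit.QuantumFields.BalabanUV.Beta.GAN24.DiagramVolumeLimitPairs (l1_windowMap_sub_castT_ge l1_windowMap_neg norm_le_exp_window_of_entryDecay)
open Summit.QuantumFields.BalabanUV.Beta.GAN24.VolumeLimitPairsFibre (tendsto_mul_pair' exists_tendsto_inv_pair norm_one_sub_smul_apply_le tendsto_one_sub_smul_pair)
open Summit.QuantumFields.BalabanUV.Beta.GAN24.FinePropagatorDecay (exists_fineWindowDecay_calGlev)
open Summit.QuantumFields.BalabanUV.Beta.GAN24.FineInsertionVolumeLimit (tendsto_calGlev_pair reindex_avgTow_eq)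
open Literature.MathematicalPhysics.QuantumFieldTheory.Balaban1983to89.Beta.LimitRate (StepRate limKernelOf KernelInputs)
open Summit.QuantumFields.BalabanUV.T4Continuum.CoerciveInverseTower (Coercive)
open Summit.QuantumFields.BalabanUV.T4Continuum.BalabanAveragedCoercive (gammaB gammaB_pos)
open Summit.QuantumFields.BalabanUV.T4Continuum.BackgroundResolventTower (opNorm_avgTow_perturbed_sub_le)
open Summit.QuantumFields.BalabanUV.T4Continuum.CTWeightedCoercivity (conjMat WCoercive)
open Summit.QuantumFields.BalabanUV.T4Continuum.CTKingTowerWeights (rho distK)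
open Summit.QuantumFields.BalabanUV.T4Continuum.CTConjugatedHbd (G2 G2_nonneg wCoercive_calDa_of_conjDefect)
open Summit.QuantumFields.BalabanUV.T4Continuum.CTConjDefectDischarge (conjDefect_calDalev_rho max_JA_lt_gamD)
open Summit.QuantumFields.BalabanUV.T4Continuum.DirichletRegionTower (gamD gamD_pos)
open Summit.QuantumFields.BalabanUV.T4Continuum.ScalarAveragedPropagator (gammaPs)
open Summit.QuantumFields.BalabanUV.T4Continuum.ScalarAveragedCompression (sigma0)
open Summit.QuantumFields.BalabanUV.T4Continuum.CTScalarGreen (Jfree)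
open Summit.QuantumFields.BalabanUV.T4Continuum.CTGaugeTerm (deltaK)
open Summit.QuantumFields.BalabanUV.T4Continuum.CTVectorPropagator (JA)
open Summit.QuantumFields.BalabanUV.T4Continuum.DecayRateInterpolation (EntryDecay TwoLevelDecayRate entryDecay_sub)
open Summit.QuantumFields.BalabanUV.Beta.GAN24.EffectiveFormDecayBackground (hdecB_pert_of_wCoercive exists_decay_inv_pertCov_QB twoLevelDecayRate_effForm_perturbed)
open Summit.QuantumFields.BalabanUV.Beta.GAN24.UnitLatticeDecayAlgebra (distK_nonneg distK_self entryDecay_smul entryDecay_one)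
open Summit.QuantumFields.BalabanUV.Beta.GAN24.EffectiveFormDecay (entryDecay_of_le_rate)
open Summit.QuantumFields.BalabanUV.Beta.GAN24.DiagramDecayAlgebra (twoLevelDecayRate_of_le_rate)
open Summit.QuantumFields.BalabanUV.Beta.GAN24.DiagramVolumeLimitSandwich (tendsto_one_pair)
open Summit.QuantumFields.BalabanUV.Beta.GAN24.DiagramVolumeLimit (conv_of_decay_of_tendsto)
open Summit.QuantumFields.BalabanUV.T4Continuum.PerturbationAlgebra (BoundedBackground)
open Summit.QuantumFields.BalabanUV.Beta.GAN24.CouplingLetterStencil (norm_couplingLetter_mul_apply_le tendsto_couplingLetter_mul_pair perturbationLaws_couplingLetter hPc_couplingLetter)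
open Summit.QuantumFields.BalabanUV.Beta.GAN24.PerturbedPropagatorVolumeLimit (pertInv_eq one_sub_one_smul one_add_smul_eq tendsto_avgTow_pair_of_fine)
open Summit.QuantumFields.BalabanUV.Beta.GAN24.PerturbedEffectiveFormVolumeLimit (avgTow_inv_calDalev_eq one_sub_half_ratio_lt_one castT_zero)
open Summit.QuantumFields.BalabanUV.Beta.GAN24.CouplingEffectiveFormDecay (exists_decay_inv_pertCov_QB_coupling twoLevelDecayRate_effForm_perturbed_coupling)

variable {d : ℕ} (L : ℕ) [NeZero L]

/-! ## §1 EL₂ of the perturbed fine propagator and of `c_k(u)` for coupling letters -/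

section Perturbed

variable (a : ℝ) (ha : 0 < a)

/-- **`tendsto_pertInv_pair` — EL₂ OF THE PERTURBED FINE PROPAGATOR, MODULO THE BACKGROUND's POINTWISE LIMIT** [our proof] (`d ≥ 3`, `a > 0`, level `k`, along the even cubic volumes
`2(t+1)`; `κ₀ = d(α+β)Cst`): for a volume-indexed family of backgrounds with `LipschitzBackground L (cubic d (2(t+1))) (V t) α β` (constants uniform in the volume) whose level-`k`
readings converge at every fine integer point (EL₁ — DISPLAYED), and every coupling `‖u‖ ≤ T` with `T·κ₀ < 1`, the perturbed fine propagator has pair entry limits: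
`∀ f g z z′, ∃ s, (Δ_a^{(k)} + u·P(V_t)^{(k)})⁻¹((ẑ_t,f),(ẑ′_t,g)) → s`.  Route: `𝒢·(1 + u·P𝒢)⁻¹`; PART 144 on `A_t = 1 + u·P𝒢` ((a) `‖1 − A_t‖ ≤ Tκ₀`, (b) §1's decay, (c) §2's EL₂),
then PART 144's left-decaying pair product with `𝒢`. [cite: Balaban1987RG1, p.264 (after (1.21): the `T ↗ ℤ^d` limit)] -/
theorem tendsto_pertInv_pair_coupling (hd : 3 ≤ d) {α β α' β' T : ℝ} (hT : T * (2 * (d * (α + β) * Cst d a) + α' * Cst d a) < 1) (k : ℕ)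
    {V₁ V₂ : (t : ℕ) → (k : ℕ) → Fin d → (idx L (cubic d (evenPeriod t)) k → ℂ)} {W : (t : ℕ) → (k : ℕ) → (idx L (cubic d (evenPeriod t)) k → ℂ)}
    (hV₁ : ∀ t, LipschitzBackground L (cubic d (evenPeriod t)) (V₁ t) α β) (hV₂ : ∀ t, LipschitzBackground L (cubic d (evenPeriod t)) (V₂ t) α β)
    (hW : ∀ t, BoundedBackground L (cubic d (evenPeriod t)) (W t) α' β')
    (hV₁1 : ∀ (μ f : Fin d) (z : Fin d → ℤ), ∃ s : ℂ, Tendsto (fun t => V₁ t k μ (castT (cubic d (lev L k * evenPeriod t)) z, f)) atTop (𝓝 s))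
    (hV₂1 : ∀ (μ f : Fin d) (z : Fin d → ℤ), ∃ s : ℂ, Tendsto (fun t => V₂ t k μ (castT (cubic d (lev L k * evenPeriod t)) z, f)) atTop (𝓝 s))
    (hW1 : ∀ (f : Fin d) (z : Fin d → ℤ), ∃ s : ℂ, Tendsto (fun t => W t k (castT (cubic d (lev L k * evenPeriod t)) z, f)) atTop (𝓝 s))
    {u : ℂ} (hu : ‖u‖ ≤ T) (f g : Fin d) (z z' : Fin d → ℤ) :
    ∃ s : ℂ, Tendsto (fun t => (calDalev L (cubic d (evenPeriod t)) a ha k + u • (Pmodel L (cubic d (evenPeriod t)) (V₁ t) k + (Pmodel L (cubic d (evenPeriod t)) (V₂ t) k)ᴴ + Matrix.diagonal (W t k)))⁻¹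
      (castT (cubic d (lev L k * evenPeriod t)) z, f) (castT (cubic d (lev L k * evenPeriod t)) z', g)) atTop (𝓝 s) := by
  have hd1 : 1 ≤ d := le_trans (by norm_num) hd
  have hd0 : (0 : ℝ) < d := by exact_mod_cast lt_of_lt_of_le zero_lt_one hd1
  have hn : (0 : ℝ) < lev L k := by exact_mod_cast Nat.pos_of_ne_zero (NeZero.ne (lev L k))
  have hside : Tendsto (fun t => lev L k * evenPeriod t) atTop atTop :=
    Filter.Tendsto.const_mul_atTop' (Nat.pos_of_ne_zero (NeZero.ne (lev L k))) tendsto_evenPeriod |>.congr fun t => by ring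
  set κ₀ : ℝ := 2 * (d * (α + β) * Cst d a) + α' * Cst d a with hκ₀
  have hαβ : 0 ≤ α ∧ 0 ≤ β := (hV₁ 0).nonneg
  have hα' : 0 ≤ α' := (hW 0).nonneg.1
  have hκ₀0 : 0 ≤ κ₀ := by have := Cst_nonneg d a; have := hαβ.1; have := hαβ.2; positivity
  have hT0 : 0 ≤ T := (norm_nonneg u).trans hu
  have huκ : ‖u‖ * κ₀ ≤ T * κ₀ := mul_le_mul_of_nonneg_right hu hκ₀0
  -- the fine window decay of `𝒢` (PART 145), on the right and on the left, and its EL₂ (PART 146)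
  obtain ⟨κ, C, hκ, hC, hdec⟩ := exists_fineWindowDecay_calGlev L a ha
  have hδ : 0 < κ / (d * lev L k) := div_pos hκ (mul_pos hd0 hn)
  have hGr : ∀ t (w : Site d (lev L k * evenPeriod t)) (g : Fin d) (y : Site d (lev L k * evenPeriod t)) (h : Fin d),
      ‖calGlev L (cubic d (evenPeriod t)) a ha k (w, g) (y, h)‖ ≤ C * Real.exp (-(κ / (d * lev L k)) * l1 (windowMap d (lev L k * evenPeriod t) (w - y))) :=
    fun t w g y h => hdec (evenPeriod t) k w y g h
  have hGl : ∀ t (x : Site d (lev L k * evenPeriod t)) (f : Fin d) (w : Site d (lev L k * evenPeriod t)) (g : Fin d),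
      ‖calGlev L (cubic d (evenPeriod t)) a ha k (x, f) (w, g)‖ ≤ C * Real.exp (-(κ / (d * lev L k)) * l1 (windowMap d (lev L k * evenPeriod t) (w - x))) := by
    intro t x f w g
    have h := hdec (evenPeriod t) k x w f g
    rwa [show x - w = -(w - x) from (neg_sub w x).symm, l1_windowMap_neg] at h
  have hGel := fun f g w w' => tendsto_calGlev_pair L a ha hd k f g w w'
  -- `X_t = P(V_t)·𝒢`: window decay (§1) and EL₂ (§2)
  set CX : ℝ := 2 * (d * (α * lev L k * ((Real.exp (3 * (κ / (d * lev L k))) + 1) * C))) + α' * C with hCX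
  have hCX0 : 0 ≤ CX := by have := hαβ.1; positivity
  have hXdec : ∀ t (w : Site d (lev L k * evenPeriod t)) (g : Fin d) (y : Site d (lev L k * evenPeriod t)) (h : Fin d),
      ‖((Pmodel L (cubic d (evenPeriod t)) (V₁ t) k + (Pmodel L (cubic d (evenPeriod t)) (V₂ t) k)ᴴ + Matrix.diagonal (W t k)) * calGlev L (cubic d (evenPeriod t)) a ha k) (w, g) (y, h)‖
        ≤ CX * Real.exp (-(κ / (d * lev L k)) * l1 (windowMap d (lev L k * evenPeriod t) (w - y))) :=
    fun t w g y h => norm_couplingLetter_mul_apply_le L (evenPeriod t) (hV₁ t) (hV₂ t) (hW t) k hC hδ.le (hGr t) w g y h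
  have hXel := tendsto_couplingLetter_mul_pair L (side := evenPeriod) k V₁ V₂ W hV₁1 hV₂1 hW1 (G := fun t => calGlev L (cubic d (evenPeriod t)) a ha k) hGel
  -- `A_t = 1 + u·X_t`: (a) Neumann ratio, (b) window decay, (c) EL₂
  have hXop : ∀ t, ‖(Pmodel L (cubic d (evenPeriod t)) (V₁ t) k + (Pmodel L (cubic d (evenPeriod t)) (V₂ t) k)ᴴ + Matrix.diagonal (W t k)) * calGlev L (cubic d (evenPeriod t)) a ha k‖ ≤ κ₀ := by
    intro t
    have h := (perturbationLaws_couplingLetter L (cubic d (evenPeriod t)) a ha hd1 (hV₁ t) (hV₂ t) (hW t)).opNorm_P_mul_inv_le k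
    rwa [calDalev_inv] at h
  have hAq : ∀ t, ‖(1 : Matrix (idx L (cubic d (evenPeriod t)) k) (idx L (cubic d (evenPeriod t)) k) ℂ)
      - (1 : ℂ) • (1 + u • ((Pmodel L (cubic d (evenPeriod t)) (V₁ t) k + (Pmodel L (cubic d (evenPeriod t)) (V₂ t) k)ᴴ + Matrix.diagonal (W t k)) * calGlev L (cubic d (evenPeriod t)) a ha k))‖ ≤ T * κ₀ := by
    intro t
    rw [one_sub_one_smul, neg_smul, norm_neg]
    exact (opNorm_smul_le_of_le (hXop t) u).trans huκ
  have hAdec : ∀ t (w : Site d (lev L k * evenPeriod t)) (g : Fin d) (y : Site d (lev L k * evenPeriod t)) (h : Fin d),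
      ‖((1 : Matrix (idx L (cubic d (evenPeriod t)) k) (idx L (cubic d (evenPeriod t)) k) ℂ)
          + u • ((Pmodel L (cubic d (evenPeriod t)) (V₁ t) k + (Pmodel L (cubic d (evenPeriod t)) (V₂ t) k)ᴴ + Matrix.diagonal (W t k)) * calGlev L (cubic d (evenPeriod t)) a ha k)) (w, g) (y, h)‖
        ≤ (1 + ‖-u‖ * CX) * Real.exp (-(κ / (d * lev L k)) * l1 (windowMap d (lev L k * evenPeriod t) (w - y))) := by
    intro t w g y h
    rw [one_add_smul_eq]
    exact norm_one_sub_smul_apply_le (lev L k * evenPeriod t) (-u) (hXdec t) w g y h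
  have hAel : ∀ (f g : Fin d) (z z' : Fin d → ℤ), ∃ s : ℂ, Tendsto (fun t => ((1 : Matrix (idx L (cubic d (evenPeriod t)) k) (idx L (cubic d (evenPeriod t)) k) ℂ)
        + u • ((Pmodel L (cubic d (evenPeriod t)) (V₁ t) k + (Pmodel L (cubic d (evenPeriod t)) (V₂ t) k)ᴴ + Matrix.diagonal (W t k)) * calGlev L (cubic d (evenPeriod t)) a ha k))
      (castT (cubic d (lev L k * evenPeriod t)) z, f) (castT (cubic d (lev L k * evenPeriod t)) z', g)) atTop (𝓝 s) := by
    intro f g z z'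
    obtain ⟨s, hs⟩ := tendsto_one_sub_smul_pair (d := d) (F := Fin d) (side := fun t => lev L k * evenPeriod t) hside (-u) hXel f g z z'
    refine ⟨s, hs.congr fun t => ?_⟩
    rw [← one_add_smul_eq]
  have hAinv := exists_tendsto_inv_pair (d := d) (F := Fin d) (side := fun t => lev L k * evenPeriod t) hside
    (A := fun t => (1 : Matrix (idx L (cubic d (evenPeriod t)) k) (idx L (cubic d (evenPeriod t)) k) ℂ)
      + u • ((Pmodel L (cubic d (evenPeriod t)) (V₁ t) k + (Pmodel L (cubic d (evenPeriod t)) (V₂ t) k)ᴴ + Matrix.diagonal (W t k)) * calGlev L (cubic d (evenPeriod t)) a ha k)) (τ := 1) hAq hT hAdec hδ hAel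
  -- `A_t⁻¹` is entrywise bounded by the Neumann bound
  have hAinvb : ∀ t (w : Site d (lev L k * evenPeriod t)) (g : Fin d) (y : Site d (lev L k * evenPeriod t)) (h : Fin d),
      ‖((1 : Matrix (idx L (cubic d (evenPeriod t)) k) (idx L (cubic d (evenPeriod t)) k) ℂ)
          + u • ((Pmodel L (cubic d (evenPeriod t)) (V₁ t) k + (Pmodel L (cubic d (evenPeriod t)) (V₂ t) k)ᴴ + Matrix.diagonal (W t k)) * calGlev L (cubic d (evenPeriod t)) a ha k))⁻¹ (w, g) (y, h)‖ ≤ (1 - T * κ₀)⁻¹ :=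
    fun t w g y h => (norm_entry_le_opNorm _ _ _).trans (opNorm_inv_one_add_le ((opNorm_smul_le_of_le (hXop t) u).trans huκ) hT)
  -- `(Δ_a + uP)⁻¹ = 𝒢·A_t⁻¹`: pair product, left factor decaying
  obtain ⟨s, hs⟩ := tendsto_mul_pair' (d := d) (F := Fin d) (side := fun t => lev L k * evenPeriod t) hside
    (X := fun t => calGlev L (cubic d (evenPeriod t)) a ha k)
    (Y := fun t => ((1 : Matrix (idx L (cubic d (evenPeriod t)) k) (idx L (cubic d (evenPeriod t)) k) ℂ)
      + u • ((Pmodel L (cubic d (evenPeriod t)) (V₁ t) k + (Pmodel L (cubic d (evenPeriod t)) (V₂ t) k)ᴴ + Matrix.diagonal (W t k)) * calGlev L (cubic d (evenPeriod t)) a ha k))⁻¹) hGl hδ hAinvb hGel hAinv f g z z'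
  refine ⟨s, hs.congr fun t => ?_⟩
  rw [pertInv_eq]


/-- **`tendsto_pertCov_pair` — EL₂ OF THE PERTURBED BLOCK COVARIANCE `c_k(u) = L^{dk}Q_k(Δ_a^{(k)} + u·P(V_t)^{(k)})⁻¹Q_kᴴ` ON THE UNIT LATTICE, MODULO THE BACKGROUND's POINTWISE
LIMIT** [our proof] (hypotheses of `tendsto_pertInv_pair`): `∀ μ ν z z′, ∃ s, c_k(u)(e(ẑ_t,μ), e(ẑ′_t,ν)) → s` along the even cubic volumes — the (c) input of PART 144 for
`c_k(u)⁻¹` (PART 152). [cite: Balaban1987RG1, p.264 (after (1.21): the `T ↗ ℤ^d` limit)] -/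
theorem tendsto_pertCov_pair_coupling (hd : 3 ≤ d) {α β α' β' T : ℝ} (hT : T * (2 * (d * (α + β) * Cst d a) + α' * Cst d a) < 1) (k : ℕ)
    {V₁ V₂ : (t : ℕ) → (k : ℕ) → Fin d → (idx L (cubic d (evenPeriod t)) k → ℂ)} {W : (t : ℕ) → (k : ℕ) → (idx L (cubic d (evenPeriod t)) k → ℂ)}
    (hV₁ : ∀ t, LipschitzBackground L (cubic d (evenPeriod t)) (V₁ t) α β) (hV₂ : ∀ t, LipschitzBackground L (cubic d (evenPeriod t)) (V₂ t) α β)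
    (hW : ∀ t, BoundedBackground L (cubic d (evenPeriod t)) (W t) α' β')
    (hV₁1 : ∀ (μ f : Fin d) (z : Fin d → ℤ), ∃ s : ℂ, Tendsto (fun t => V₁ t k μ (castT (cubic d (lev L k * evenPeriod t)) z, f)) atTop (𝓝 s))
    (hV₂1 : ∀ (μ f : Fin d) (z : Fin d → ℤ), ∃ s : ℂ, Tendsto (fun t => V₂ t k μ (castT (cubic d (lev L k * evenPeriod t)) z, f)) atTop (𝓝 s))
    (hW1 : ∀ (f : Fin d) (z : Fin d → ℤ), ∃ s : ℂ, Tendsto (fun t => W t k (castT (cubic d (lev L k * evenPeriod t)) z, f)) atTop (𝓝 s))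
    {u : ℂ} (hu : ‖u‖ ≤ T) (μ ν : Fin d) (z z' : Fin d → ℤ) :
    ∃ s : ℂ, Tendsto (fun t => Matrix.reindex (unitIdx L (cubic d (evenPeriod t))) (unitIdx L (cubic d (evenPeriod t)))
        (avgTow (QBlev L (cubic d (evenPeriod t))) ((L : ℝ) ^ d)
          (fun k' => (calDalev L (cubic d (evenPeriod t)) a ha k' + u • (Pmodel L (cubic d (evenPeriod t)) (V₁ t) k' + (Pmodel L (cubic d (evenPeriod t)) (V₂ t) k')ᴴ + Matrix.diagonal (W t k')))⁻¹) k)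
        (castT (cubic d (evenPeriod t)) z, μ) (castT (cubic d (evenPeriod t)) z', ν)) atTop (𝓝 s) :=
  tendsto_avgTow_pair_of_fine L k
    (X := fun t k' => (calDalev L (cubic d (evenPeriod t)) a ha k' + u • (Pmodel L (cubic d (evenPeriod t)) (V₁ t) k' + (Pmodel L (cubic d (evenPeriod t)) (V₂ t) k')ᴴ + Matrix.diagonal (W t k')))⁻¹)
    (fun f g w w' => tendsto_pertInv_pair_coupling L a ha hd hT k hV₁ hV₂ hW hV₁1 hV₂1 hW1 hu f g w w') μ ν z z'

end Perturbed

/-! ## §2 The Neumann ratio and the volume-uniform window decay of `c_k(u)` on the disc -/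

section OneTorus

variable (M : Fin d → ℕ) [hM : ∀ μ, NeZero (M μ)] (a : ℝ) (ha : 0 < a)

/-- **`opNorm_one_sub_smul_pertCov_le` — (a) THE NEUMANN RATIO ON THE DISC** [our proof] (`d ≥ 1`; any torus; `κ₀ = d(α+β)Cst`): for a Lipschitz background `(α, β)`, `‖u‖ ≤ T` with
`Tκ₀ ≤ 1∕2` and `4Tκ₀Cst ≤ γ_B`: `‖1 − Cst⁻¹•c_k(u)‖ ≤ 1 − γ_B∕(2Cst)` (read on `Tor M × Fin d`) — PART 138's Hermitian ratio `1 − γ_B∕Cst` for `c_k` plus `Cst⁻¹‖c_k(u) − c_k‖ ≤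
‖u‖κ₀(1 − ‖u‖κ₀)⁻¹ ≤ 2Tκ₀ ≤ γ_B∕(2Cst)` (NE2's `opNorm_avgTow_perturbed_sub_le`). -/
theorem opNorm_one_sub_smul_pertCov_le_coupling (hd : 1 ≤ d) {V₁ V₂ : (k : ℕ) → Fin d → (idx L M k → ℂ)} {W : (k : ℕ) → (idx L M k → ℂ)} {α β α' β' : ℝ}
    (hV₁ : LipschitzBackground L M V₁ α β) (hV₂ : LipschitzBackground L M V₂ α β) (hW : BoundedBackground L M W α' β') {T : ℝ}
    (hT₁ : T * (2 * (d * (α + β) * Cst d a) + α' * Cst d a) ≤ 1 / 2) (hT₃ : 4 * T * (2 * (d * (α + β) * Cst d a) + α' * Cst d a) * Cst d a ≤ gammaB d a) {u : ℂ} (hu : ‖u‖ ≤ T) (k : ℕ) :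
    ‖(1 : Matrix (Tor M × Fin d) (Tor M × Fin d) ℂ) - (((Cst d a)⁻¹ : ℝ) : ℂ) •
        Matrix.reindex (unitIdx L M) (unitIdx L M) (avgTow (QBlev L M) ((L : ℝ) ^ d) (fun k => (calDalev L M a ha k + u • (Pmodel L M V₁ k + (Pmodel L M V₂ k)ᴴ + Matrix.diagonal (W k)))⁻¹) k)‖
      ≤ 1 - gammaB d a / (2 * Cst d a) := by
  rw [one_sub_smul_reindex, opNorm_reindex]
  set κ₀ : ℝ := 2 * (d * (α + β) * Cst d a) + α' * Cst d a with hκ₀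
  set cu := avgTow (QBlev L M) ((L : ℝ) ^ d) (fun k => (calDalev L M a ha k + u • (Pmodel L M V₁ k + (Pmodel L M V₂ k)ᴴ + Matrix.diagonal (W k)))⁻¹) k with hcu
  have hC : 0 < Cst d a := lt_of_lt_of_le zero_lt_one (le_max_of_le_right (le_max_right _ _))
  have hκ₀0 : 0 ≤ κ₀ := by have := hV₁.nonneg.1; have := hV₁.nonneg.2; have := hW.nonneg.1; have := hC.le; positivity
  have hT0 : 0 ≤ T := (norm_nonneg u).trans hu
  have huκ : ‖u‖ * κ₀ ≤ T * κ₀ := mul_le_mul_of_nonneg_right hu hκ₀0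
  have huκ1 : ‖u‖ * κ₀ < 1 := by linarith
  -- PART 138's Hermitian ratio for `c_k`, read back on `idx`
  have h138 := opNorm_one_sub_smul_unitCovB_le L M a ha hd k
  rw [one_sub_smul_reindex, opNorm_reindex] at h138
  -- NE2's Lipschitz bound in the coupling
  have hr : (0 : ℝ) < (L : ℝ) ^ d := pow_pos (by exact_mod_cast Nat.pos_of_ne_zero (NeZero.ne L)) d
  have hγ : ∀ k, ‖(calDalev L M a ha k)⁻¹‖ ≤ ((Cst d a)⁻¹)⁻¹ := fun k => by rw [inv_inv]; exact opNorm_inv_calDalev_le L M a ha k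
  have hpert := perturbationLaws_couplingLetter L M a ha hd hV₁ hV₂ hW
  have hE := opNorm_avgTow_perturbed_sub_le hr (opNorm_QBlev_sq_le L M) (isUnit_det_calDalev L M a ha) hγ hpert.opNorm_P_mul_inv_le
    hpert.opNorm_inv_mul_P_le huκ1 k
  rw [inv_inv, avgTow_inv_calDalev_eq, ← hcu] at hE
  have hν : (1 - ‖u‖ * κ₀)⁻¹ ≤ 2 := by
    have h1 : (1 : ℝ) / 2 ≤ 1 - ‖u‖ * κ₀ := by linarith
    have := inv_anti₀ (by norm_num : (0 : ℝ) < 1 / 2) h1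
    rwa [one_div, inv_inv] at this
  have hν0 : 0 ≤ (1 - ‖u‖ * κ₀)⁻¹ := inv_nonneg.mpr (by linarith)
  have hτ : ‖(((Cst d a)⁻¹ : ℝ) : ℂ)‖ = (Cst d a)⁻¹ := by rw [Complex.norm_real, Real.norm_of_nonneg (inv_nonneg.mpr hC.le)]
  have e1 : (1 : Matrix (idx L M 0) (idx L M 0) ℂ) - (((Cst d a)⁻¹ : ℝ) : ℂ) • cu
      = ((1 : Matrix (idx L M 0) (idx L M 0) ℂ) - (((Cst d a)⁻¹ : ℝ) : ℂ) • unitCovB L M a ha k) - (((Cst d a)⁻¹ : ℝ) : ℂ) • (cu - unitCovB L M a ha k) := by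
    rw [smul_sub]; abel
  rw [e1]
  have h2 : ‖(((Cst d a)⁻¹ : ℝ) : ℂ) • (cu - unitCovB L M a ha k)‖ ≤ ‖u‖ * κ₀ * (1 - ‖u‖ * κ₀)⁻¹ := by
    rw [norm_smul, hτ]
    calc (Cst d a)⁻¹ * ‖cu - unitCovB L M a ha k‖ ≤ (Cst d a)⁻¹ * (‖u‖ * κ₀ * Cst d a * (1 - ‖u‖ * κ₀)⁻¹) :=
          mul_le_mul_of_nonneg_left hE (inv_nonneg.mpr hC.le)
      _ = ‖u‖ * κ₀ * (1 - ‖u‖ * κ₀)⁻¹ := by field_simp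
  have h3 : ‖u‖ * κ₀ * (1 - ‖u‖ * κ₀)⁻¹ ≤ T * κ₀ * 2 := mul_le_mul huκ hν hν0 (by positivity)
  have h4 : T * κ₀ * 2 ≤ gammaB d a / (2 * Cst d a) := by
    rw [le_div_iff₀ (by positivity)]
    have : 4 * T * κ₀ * Cst d a ≤ gammaB d a := by rw [hκ₀]; linarith [hT₃]
    linarith
  calc ‖((1 : Matrix (idx L M 0) (idx L M 0) ℂ) - (((Cst d a)⁻¹ : ℝ) : ℂ) • unitCovB L M a ha k) - (((Cst d a)⁻¹ : ℝ) : ℂ) • (cu - unitCovB L M a ha k)‖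
      ≤ ‖(1 : Matrix (idx L M 0) (idx L M 0) ℂ) - (((Cst d a)⁻¹ : ℝ) : ℂ) • unitCovB L M a ha k‖ + ‖(((Cst d a)⁻¹ : ℝ) : ℂ) • (cu - unitCovB L M a ha k)‖ := norm_sub_le _ _
    _ ≤ (1 - gammaB d a / Cst d a) + gammaB d a / (2 * Cst d a) := add_le_add h138 (h2.trans (h3.trans h4))
    _ = 1 - gammaB d a / (2 * Cst d a) := by ring

end OneTorus

section Window

variable (a : ℝ) (ha : 0 < a)

/-- **`exists_windowDecay_pertCov` — (b) VOLUME-UNIFORM WINDOW DECAY OF `c_k(u)`** [our proof]: on PART 129's coupling disc (admissible fine rate `κ` at `a′`, `Tκ_c ≤ 1∕2`) there is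
`B_c ≥ 0` (from `(d, a, a′, κ)`) with `‖c_k(u)(e(w,λ), e(y,ν))‖ ≤ B_c·e^{−(κ∕d)|windowMap(w − y)|₁}` for EVERY cubic torus, Lipschitz background `(α, β)`, `‖u‖ ≤ T`, level and pair —
PART 129's `hdecB_pert_of_wCoercive` (with NE2's `conjDefect_calDalev_rho` and PART 124's `hPc_firstOrder`) read through PART 142's window inequality. -/
theorem exists_windowDecay_pertCov_coupling {α β α' β' a' κ T : ℝ} (hα : 0 ≤ α) (hβ : 0 ≤ β) (hα' : 0 ≤ α') (ha' : 0 < a') (hκ0 : 0 < κ)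
    (hγ' : Jfree d a' κ 1 < gammaPs d a') (hδ' : deltaK d a' κ 1 < sigma0 d a' ^ 2) (hJA : JA d a a' κ 1 < gamD d a)
    (hT₂ : T * (d * (α * G2 d a (max (JA d a a' κ 1) 0) (gamD d a - max (JA d a a' κ 1) 0) κ)
      + d * (Real.exp |κ| * (α * G2 d a (max (JA d a a' κ 1) 0) (gamD d a - max (JA d a a' κ 1) 0) κ + β * (gamD d a - max (JA d a a' κ 1) 0)⁻¹))
      + α' * (gamD d a - max (JA d a a' κ 1) 0)⁻¹) ≤ 1 / 2) :
    ∃ Bc : ℝ, 0 ≤ Bc ∧ ∀ (s : ℕ) [NeZero s] (V₁ V₂ : (k : ℕ) → Fin d → (idx L (cubic d s) k → ℂ)) (W : (k : ℕ) → (idx L (cubic d s) k → ℂ)),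
      LipschitzBackground L (cubic d s) V₁ α β → LipschitzBackground L (cubic d s) V₂ α β → BoundedBackground L (cubic d s) W α' β' →
      ∀ (u : ℂ), ‖u‖ ≤ T → ∀ (k : ℕ) (w : Site d s) (l : Fin d) (y : Site d s) (ν : Fin d),
        ‖Matrix.reindex (unitIdx L (cubic d s)) (unitIdx L (cubic d s))
            (avgTow (QBlev L (cubic d s)) ((L : ℝ) ^ d) (fun k => (calDalev L (cubic d s) a ha k + u • (Pmodel L (cubic d s) V₁ k + (Pmodel L (cubic d s) V₂ k)ᴴ + Matrix.diagonal (W k)))⁻¹) k) (w, l) (y, ν)‖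
          ≤ Bc * Real.exp (-(κ / d) * l1 (windowMap d s (w - y))) := by
  set J : ℝ := max (JA d a a' κ 1) 0 with hJdef
  have hJ0 : 0 ≤ J := le_max_right _ _
  have hJγ : J < gamD d a := max_JA_lt_gamD a hJA
  set κc : ℝ := d * (α * G2 d a J (gamD d a - J) κ) + d * (Real.exp |κ| * (α * G2 d a J (gamD d a - J) κ + β * (gamD d a - J)⁻¹)) + α' * (gamD d a - J)⁻¹ with hκc
  have hκc0 : 0 ≤ κc := by
    have := G2_nonneg (d := d) a J (sub_pos.mpr hJγ) κ
    have : 0 ≤ (gamD d a - J)⁻¹ := inv_nonneg.mpr (sub_pos.mpr hJγ).le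
    positivity
  refine ⟨(gamD d a - J)⁻¹ * 2 * Real.exp (κ * 4), by have := sub_pos.mpr hJγ; positivity, fun s _ V₁ V₂ W hV₁ hV₂ hW u hu k w l y ν => ?_⟩
  have hWc : ∀ (k : ℕ) (y : idx L (cubic d s) 0), WCoercive (calDalev L (cubic d s) a ha k) κ (rho L (cubic d s) k y) (gamD d a - J) :=
    fun k y => wCoercive_calDa_of_conjDefect (lev L k) (one_le_lev' L k) (cubic d s) a ha (conjDefect_calDalev_rho L (cubic d s) a ha ha' hγ' hδ' k y)
  have hPc : ∀ (k : ℕ) (y : idx L (cubic d s) 0),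
      ‖conjMat κ (rho L (cubic d s) k y) (rho L (cubic d s) k y) ((Pmodel L (cubic d s) V₁ k + (Pmodel L (cubic d s) V₂ k)ᴴ + Matrix.diagonal (W k)))
        * conjMat κ (rho L (cubic d s) k y) (rho L (cubic d s) k y) (calDalev L (cubic d s) a ha k)⁻¹‖ ≤ κc :=
    fun k y => hPc_couplingLetter L (cubic d s) a ha hV₁ hV₂ hW hJ0 hJγ k y (conjDefect_calDalev_rho L (cubic d s) a ha ha' hγ' hδ' k y)
  have htc : ‖u‖ * κc < 1 := by have := mul_le_mul_of_nonneg_right hu hκc0; linarith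
  have hdec0 := hdecB_pert_of_wCoercive L (cubic d s) a ha (P := fun k => (Pmodel L (cubic d s) V₁ k + (Pmodel L (cubic d s) V₂ k)ᴴ + Matrix.diagonal (W k))) hκ0.le (sub_pos.mpr hJγ) hWc hPc htc k
  have hνc : (1 - ‖u‖ * κc)⁻¹ ≤ 2 := by
    have h1 : (1 : ℝ) / 2 ≤ 1 - ‖u‖ * κc := by have := mul_le_mul_of_nonneg_right hu hκc0; linarith
    have := inv_anti₀ (by norm_num : (0 : ℝ) < 1 / 2) h1
    rwa [one_div, inv_inv] at this
  have hdec : EntryDecay (distK L (cubic d s)) (avgTow (QBlev L (cubic d s)) ((L : ℝ) ^ d) (fun k => (calDalev L (cubic d s) a ha k + u • (Pmodel L (cubic d s) V₁ k + (Pmodel L (cubic d s) V₂ k)ᴴ + Matrix.diagonal (W k)))⁻¹) k)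
      ((gamD d a - J)⁻¹ * 2 * Real.exp (κ * 4)) κ := by
    refine hdec0.mono ?_
    have h1 : 0 ≤ (gamD d a - J)⁻¹ := inv_nonneg.mpr (sub_pos.mpr hJγ).le
    gcongr
  have h := norm_le_exp_window_of_entryDecay L s hκ0.le hdec w l y ν
  simpa only [Matrix.reindex_apply, Matrix.submatrix_apply] using h

end Window

end Summit.QuantumFields.BalabanUV.Beta.GAN24.CouplingPerturbedVolumeLimit

end
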